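import Literature.Computation.Certificates.SemidefiniteRigorousBoundsEnclosure
import Literature.Computation.Certificates.SemidefiniteRigorousBoundsSlackLambdaMax

/-!
# The UPPER side of the LMI-form rigorous bound over an entrywise DATA BOX (interval input data)

Topic `Literature/Computation/Certificates`; sibling of `SemidefiniteRigorousBounds.lean`
(`JanssonChaykinKeil.lmiForm_bound`), `SemidefiniteRigorousBoundsEnclosure.lean`
(`lmiForm_sInf_le_of_feasible`, `lmiForm_bound_on_box`) and
`SemidefiniteRigorousBoundsSlackLambdaMax.lean` (`Jansson2006.posSemidef_smul_one_sub_of_abs_rowSum_le`).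

`lmiForm_sInf_le_of_feasible` types the upper side of the inequality-form ("y-", LMI-form) program for
EXACT data: an exactly feasible point `ỹ` bounds the optimal value from above. The lower side over a box
of input data (every datum `d` of the program known only as `|d − d₀| ≤ rad(d)`) is
`lmiForm_bound_on_cell` / `lmiForm_bound_on_box` (one dual certificate, residuals charged over the box).
This file types the matching UPPER side over an entrywise data box, which the interval format of the
conic certificate verifiers (certsdp `FORMAT-problem1-addendum-interval`, §scope) records as the open
half: «a `y` feasible for ALL instances needs a robust PSD margin `≥ Σ rad·|y|` per block».

The mechanism is the one of Jansson's rigorous upper bound for interval data: ONE point `ỹ` (exact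
rationals, computed for the midpoint program) is shown feasible for EVERY instance of the box by
MARGINS — each inequality row holds at the midpoint with slack at least its radius budget
`Σ_v rad(row_i[v])·|ỹ_v| + rad(upper_i)`, and each PSD block satisfies `M_k⁰(ỹ) − m_k·1 ⪰ 0` with
`m_k` at least the absolute row sums of the entrywise radius matrix
`rad(C_k)[a,b] + Σ_v rad(F_{k,v})[a,b]·|ỹ_v|` of the block (so that every perturbation `Δ` of the block
inside the box has `λ_max(±Δ) ≤ ‖Δ‖_∞ ≤ m_k`, `Jansson2006.posSemidef_smul_one_sub_of_abs_rowSum_le`);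
equality rows carry no radius (a fixed point cannot satisfy a moving equation). Then the optimal value
of every instance is at most the objective of `ỹ` at that instance, itself at most
`c⁰·ỹ + c₀⁰ + Σ_v rad(c_v)·|ỹ_v| + rad(c₀)`.

* `JanssonChaykinKeil.posSemidef_add_of_abs_rowSum_le` — the robust PSD margin: `M − m·1 ⪰ 0`, `Δ`
  symmetric with absolute row sums `≤ m` ⟹ `M + Δ ⪰ 0`.
* `JanssonChaykinKeil.lmiForm_ineq_on_box`, `JanssonChaykinKeil.lmiForm_psd_on_box` — the margin
  conditions at the midpoint imply the inequality rows / the PSD blocks of every instance in the box.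
* `JanssonChaykinKeil.lmiForm_value_le_on_box` — the objective of `ỹ` at any instance is at most the
  box value `c⁰·ỹ + c₀⁰ + Σ_v rad(c_v)·|ỹ_v| + rad(c₀)`.
* `JanssonChaykinKeil.lmiForm_sInf_le_on_box` — the composition: for every instance of the box the
  optimal value (infimum over its feasible set) is at most the box value.
* `JanssonChaykinKeil.posSemidef_sub_smul_of_floor_le` — the reader's glue: a certified floor `f` with
  `M − f·1 ⪰ 0` and a budget `m ≤ f` give the block margin `M − m·1 ⪰ 0` (appended 2026-08-27 on the
  text owner's word rU-13).

Recorded as COROLLARIES (composition of results already in the tree), not as printed statements: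
* C. Jansson, arXiv:0707.4366 (2007) [Jansson2007], Thm 4.2 (b) (a primal feasible point bounds the
  optimal value) with the interval-data remark of §4, p. 9 («the input data may be intervals, and we
  obtain a bound for each instance within the interval data») — read on the page 2026-08-27;
* C. Jansson, D. Chaykin, C. Keil, SIAM J. Numer. Anal. 46 (2008) 180–200 [JanssonChaykinKeil2008],
  Thm 4.1 / Algorithm 4.1 (rigorous upper bound: an enclosure of primal feasible points of all
  realisations, positive definiteness of the midpoint blocks against the radius) — the standard-form
  original of the margin mechanism; here in LMI form with an exactly feasible midpoint point and
  explicit entrywise margins instead of an interval enclosure;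
* C. Jansson, Dagstuhl Seminar 05391 (2006) [Jansson2006Dagstuhl], §3 remark after Thm 3
  (`λ_max ≤ ‖·‖_∞`) — through `Jansson2006.posSemidef_smul_one_sub_of_abs_rowSum_le`.

No definitions, no named facts, no instances; six short proofs.
-/

namespace Literature.Computation.Certificates

open Matrix Finset
open scoped BigOperators

namespace JanssonChaykinKeil

section UpperBox

variable {V : Type*} [Fintype V] {E : Type*} {I : Type*}
variable {K : Type*} {σ : K → Type*} [∀ k, Fintype (σ k)] [∀ k, DecidableEq (σ k)]

/-- theorem (**robust PSD margin**, plumbing). If `M − m·1 ⪰ 0` and `Δ` is real symmetric with absolute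
row sums `Σ_b |Δ_ab| ≤ m`, then `M + Δ ⪰ 0`.  (`m·1 + Δ ⪰ 0` because `λ_max(−Δ) ≤ ‖Δ‖_∞ ≤ m`
(`Jansson2006.posSemidef_smul_one_sub_of_abs_rowSum_le`), and `M + Δ = (M − m·1) + (m·1 + Δ)`.)
[cite: Jansson2006Dagstuhl, §3, remark after Thm 3 (norm estimate of the eigenvalue shift)] — a
COROLLARY; [folklore] (Weyl / Gershgorin-type perturbation margin). CERTIFICATE KIND: robust PSD
margin of a block against an entrywise perturbation box; FIELDS: `M ↦` midpoint block, `m ↦` certified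
margin, `Δ ↦` perturbation. NOT COVERED: how `M − m·1 ⪰ 0` is certified (exact LDLᵀ / Cholesky residual). -/
theorem posSemidef_add_of_abs_rowSum_le {n : Type*} [Fintype n] [DecidableEq n]
    {M Δ : Matrix n n ℝ} {m : ℝ} (hM : (M - m • (1 : Matrix n n ℝ)).PosSemidef)
    (hΔ : Δ.IsHermitian) (hrow : ∀ a, ∑ b, |Δ a b| ≤ m) : (M + Δ).PosSemidef := by
  have hrow' : ∀ a, ∑ b, |(-Δ) a b| ≤ m := fun a => by
    simpa only [Matrix.neg_apply, abs_neg] using hrow a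
  have h1 : (m • (1 : Matrix n n ℝ) - (-Δ)).PosSemidef :=
    Jansson2006.posSemidef_smul_one_sub_of_abs_rowSum_le hΔ.neg hrow'
  have h2 : M + Δ = (M - m • (1 : Matrix n n ℝ)) + (m • (1 : Matrix n n ℝ) - (-Δ)) := by
    rw [sub_neg_eq_add]; abel
  rw [h2]
  exact hM.add h1

/-- theorem (**inequality rows of every instance from midpoint margins**). Midpoint row data
`rowI⁰, upper⁰`, instance data with `|rowI_i[v] − rowI⁰_i[v]| ≤ rI_i[v]`, `|upper_i − upper⁰_i| ≤ rU_i`,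
and a point `ỹ` with `rowI⁰_i·ỹ + Σ_v rI_i[v]·|ỹ_v| + rU_i ≤ upper⁰_i` for every row. Then
`rowI_i·ỹ ≤ upper_i` for every row of the instance — the interval evaluation of the affine row at the
fixed point, [cite: Jansson2007, §4, p. 9 (interval input data: the bound holds for each instance) with Thm 4.2 (b)]
— a COROLLARY ([folklore] interval evaluation of an affine form); plumbing for `lmiForm_sInf_le_on_box`. CERTIFICATE KIND: interval upper certificate, row margin
check; FIELDS: `rI, rU ↦` radii of the inequality rows. NOT COVERED: directed rounding (exact data). -/
theorem lmiForm_ineq_on_box (rowI rowIm : I → V → ℝ) (upper upperm : I → ℝ)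
    (rI : I → V → ℝ) (rU : I → ℝ)
    (hI : ∀ i v, |rowI i v - rowIm i v| ≤ rI i v) (hU : ∀ i, |upper i - upperm i| ≤ rU i)
    {yt : V → ℝ}
    (hineq : ∀ i, ∑ v, rowIm i v * yt v + ∑ v, rI i v * |yt v| + rU i ≤ upperm i) :
    ∀ i, ∑ v, rowI i v * yt v ≤ upper i := by
  intro i
  have h1 : ∑ v, rowI i v * yt v = ∑ v, rowIm i v * yt v + ∑ v, (rowI i v - rowIm i v) * yt v := by
    rw [← Finset.sum_add_distrib]
    exact Finset.sum_congr rfl fun v _ => by ring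
  have h2 : ∑ v, (rowI i v - rowIm i v) * yt v ≤ ∑ v, rI i v * |yt v| :=
    Finset.sum_le_sum fun v _ =>
      calc (rowI i v - rowIm i v) * yt v ≤ |(rowI i v - rowIm i v) * yt v| := le_abs_self _
        _ = |rowI i v - rowIm i v| * |yt v| := abs_mul _ _
        _ ≤ rI i v * |yt v| := mul_le_mul_of_nonneg_right (hI i v) (abs_nonneg _)
  have h3 : upperm i - upper i ≤ |upperm i - upper i| := le_abs_self _
  have h4 : |upperm i - upper i| = |upper i - upperm i| := abs_sub_comm _ _
  have h5 := hU i
  have h6 := hineq i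
  rw [h1]
  linarith

/-- theorem (**PSD blocks of every instance from midpoint margins**). Midpoint block data `C⁰_k, F⁰_{k,v}`,
instance data with `|C_k[a,b] − C⁰_k[a,b]| ≤ rC_k[a,b]`, `|F_{k,v}[a,b] − F⁰_{k,v}[a,b]| ≤ rF_{k,v}[a,b]`
and symmetric instance blocks `M_k(ỹ) = C_k + Σ_v ỹ_v F_{k,v}`, a point `ỹ` and margins `m_k` with
`M⁰_k(ỹ) − m_k·1 ⪰ 0` and `Σ_b (rC_k[a,b] + Σ_v rF_{k,v}[a,b]·|ỹ_v|) ≤ m_k` for every row `a`. Then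
`M_k(ỹ) ⪰ 0` for every block of the instance.  (`Δ_k = M_k(ỹ) − M⁰_k(ỹ)` has
`|Δ_k[a,b]| ≤ rC_k[a,b] + Σ_v rF_{k,v}[a,b]·|ỹ_v|`; `posSemidef_add_of_abs_rowSum_le`.)
[cite: JanssonChaykinKeil2008, Thm 4.1 and Algorithm 4.1 (midpoint definiteness against the radius)] —
a COROLLARY in LMI form; DEVIATIONS from print: explicit entrywise margins and `‖·‖_∞` instead of an
interval eigenvalue enclosure. CERTIFICATE KIND: interval upper certificate, block margin check;
FIELDS: `rC, rF ↦` radii of the block data, `m ↦` certified margins `λ_min(M⁰_k(ỹ)) ≥ m_k`.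
NOT COVERED: how `M⁰_k(ỹ) − m_k·1 ⪰ 0` is certified; blocks certified only on a face (no margin). -/
theorem lmiForm_psd_on_box (Cb Cbm : ∀ k, Matrix (σ k) (σ k) ℝ) (F Fm : ∀ k, V → Matrix (σ k) (σ k) ℝ)
    (rC : ∀ k, σ k → σ k → ℝ) (rF : ∀ k, V → σ k → σ k → ℝ) (m : K → ℝ)
    (hCb : ∀ k a b, |Cb k a b - Cbm k a b| ≤ rC k a b)
    (hF : ∀ k v a b, |F k v a b - Fm k v a b| ≤ rF k v a b)
    {yt : V → ℝ} (hherm : ∀ k, (Cb k + ∑ v, yt v • F k v).IsHermitian)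
    (hpsd : ∀ k, (Cbm k + ∑ v, yt v • Fm k v - m k • (1 : Matrix (σ k) (σ k) ℝ)).PosSemidef)
    (hm : ∀ k a, ∑ b, (rC k a b + ∑ v, rF k v a b * |yt v|) ≤ m k) :
    ∀ k, (Cb k + ∑ v, yt v • F k v).PosSemidef := by
  intro k
  have hpsdk := hpsd k
  have hMh : (Cbm k + ∑ v, yt v • Fm k v).IsHermitian := by
    have h1 : (m k • (1 : Matrix (σ k) (σ k) ℝ)).IsHermitian := by
      rw [Matrix.IsHermitian, Matrix.conjTranspose_smul, Matrix.conjTranspose_one, star_trivial]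
    simpa using hpsdk.1.add h1
  have hΔh : (Cb k + ∑ v, yt v • F k v - (Cbm k + ∑ v, yt v • Fm k v)).IsHermitian :=
    (hherm k).sub hMh
  have hentry : ∀ a b, |(Cb k + ∑ v, yt v • F k v - (Cbm k + ∑ v, yt v • Fm k v)) a b| ≤
      rC k a b + ∑ v, rF k v a b * |yt v| := by
    intro a b
    have hs : ∑ v, yt v * (F k v a b - Fm k v a b) =
        ∑ v, yt v * F k v a b - ∑ v, yt v * Fm k v a b := by
      rw [← Finset.sum_sub_distrib]
      exact Finset.sum_congr rfl fun v _ => by ring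
    have e : (Cb k + ∑ v, yt v • F k v - (Cbm k + ∑ v, yt v • Fm k v)) a b =
        (Cb k a b - Cbm k a b) + ∑ v, yt v * (F k v a b - Fm k v a b) := by
      simp only [Matrix.sub_apply, Matrix.add_apply, Matrix.sum_apply, Matrix.smul_apply, smul_eq_mul]
      rw [hs]
      ring
    rw [e]
    refine (abs_add_le _ _).trans (add_le_add (hCb k a b) ?_)
    refine (Finset.abs_sum_le_sum_abs _ _).trans (Finset.sum_le_sum fun v _ => ?_)
    rw [abs_mul, mul_comm]
    exact mul_le_mul_of_nonneg_right (hF k v a b) (abs_nonneg _)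
  have hrow : ∀ a, ∑ b, |(Cb k + ∑ v, yt v • F k v - (Cbm k + ∑ v, yt v • Fm k v)) a b| ≤ m k :=
    fun a => (Finset.sum_le_sum fun b _ => hentry a b).trans (hm k a)
  have key := posSemidef_add_of_abs_rowSum_le hpsdk hΔh hrow
  have e2 : Cbm k + ∑ v, yt v • Fm k v + (Cb k + ∑ v, yt v • F k v - (Cbm k + ∑ v, yt v • Fm k v)) =
      Cb k + ∑ v, yt v • F k v := by abel
  rw [e2] at key
  exact key

/-- theorem (**objective of the fixed point over the box**). With `|c_v − c⁰_v| ≤ rc_v` and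
`|c₀ − c₀⁰| ≤ rc₀`: `c·ỹ + c₀ ≤ c⁰·ỹ + c₀⁰ + Σ_v rc_v·|ỹ_v| + rc₀` — the supremum of the interval
evaluation of the objective at the fixed point, [cite: Jansson2007, Thm 4.2 (b) with the interval-data remark of §4, p. 9]
— a COROLLARY ([folklore] interval evaluation of an affine form); plumbing for `lmiForm_sInf_le_on_box`. CERTIFICATE KIND: interval upper certificate, box value;
FIELDS: `rc, rc0 ↦` radii of the objective. NOT COVERED: directed rounding (exact data). -/
theorem lmiForm_value_le_on_box (c cm : V → ℝ) (c0 c0m : ℝ) (rc : V → ℝ) (rc0 : ℝ)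
    (hc : ∀ v, |c v - cm v| ≤ rc v) (hc0 : |c0 - c0m| ≤ rc0) (yt : V → ℝ) :
    ∑ v, c v * yt v + c0 ≤ ∑ v, cm v * yt v + c0m + ∑ v, rc v * |yt v| + rc0 := by
  have h1 : ∑ v, c v * yt v = ∑ v, cm v * yt v + ∑ v, (c v - cm v) * yt v := by
    rw [← Finset.sum_add_distrib]
    exact Finset.sum_congr rfl fun v _ => by ring
  have h2 : ∑ v, (c v - cm v) * yt v ≤ ∑ v, rc v * |yt v| :=
    Finset.sum_le_sum fun v _ =>
      calc (c v - cm v) * yt v ≤ |(c v - cm v) * yt v| := le_abs_self _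
        _ = |c v - cm v| * |yt v| := abs_mul _ _
        _ ≤ rc v * |yt v| := mul_le_mul_of_nonneg_right (hc v) (abs_nonneg _)
  have h3 : c0 - c0m ≤ |c0 - c0m| := le_abs_self _
  linarith

/-- theorem (**rigorous upper bound of the optimal value over an entrywise data box, LMI form**).
Program family: objective `c·y + c₀` over `y ∈ ℝ^V` with unit variable `y_u = 1` and a-priori bounds
`|y_v| ≤ ρ_v` (`v ≠ u`), equality rows `row_e·y = rhs_e` (EXACT — no radius), inequality rows
`rowI_i·y ≤ upper_i`, PSD blocks `M_k(y) = C_k + Σ_v y_v F_{k,v} ⪰ 0`; an INSTANCE is any data with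
`|c_v − c⁰_v| ≤ rc_v`, `|c₀ − c₀⁰| ≤ rc₀`, `|rowI_i[v] − rowI⁰_i[v]| ≤ rI_i[v]`, `|upper_i − upper⁰_i| ≤ rU_i`,
`|C_k[a,b] − C⁰_k[a,b]| ≤ rC_k[a,b]`, `|F_{k,v}[a,b] − F⁰_{k,v}[a,b]| ≤ rF_{k,v}[a,b]` (symmetric blocks).
Certificate: ONE point `ỹ` (exact, for the midpoint program) with `ỹ_u = 1`, `|ỹ_v| ≤ ρ_v`, exact
equality rows, ROW MARGINS `rowI⁰_i·ỹ + Σ_v rI_i[v]·|ỹ_v| + rU_i ≤ upper⁰_i`, and BLOCK MARGINS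
`M⁰_k(ỹ) − m_k·1 ⪰ 0` with `Σ_b (rC_k[a,b] + Σ_v rF_{k,v}[a,b]·|ỹ_v|) ≤ m_k` for every row `a`.
Then for every instance the optimal value (infimum of `c·y + c₀` over its feasible set, assumed bounded
below — e.g. by `lmiForm_bound`) satisfies `inf ≤ c⁰·ỹ + c₀⁰ + Σ_v rc_v·|ỹ_v| + rc₀`.
(Proof: `ỹ` is feasible for the instance by `lmiForm_ineq_on_box` / `lmiForm_psd_on_box`;
`lmiForm_sInf_le_of_feasible`; `lmiForm_value_le_on_box`.) SOURCE:
[cite: Jansson2007, Thm 4.2 (b) and the interval-data remark of §4, p. 9] and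
[cite: JanssonChaykinKeil2008, Thm 4.1 (rigorous upper bound for interval SDP data)] — a COROLLARY;
DEVIATIONS from print: inequality (LMI) form with entrywise radii; ONE exactly feasible midpoint point
made robustly feasible by explicit margins (no interval enclosure `𝐗`, no interval linear system);
equality rows radius-free. CERTIFICATE KIND: certsdp-primal/1-type upper certificate against an
interval (entrywise-radius) certsdp-problem/1 — the UPPER twin of the box lower certificate
(`lmiForm_bound_on_box`); FIELDS: `yt ↦` the exact point, `m ↦` certified block margins,
`rc rc0 rI rU rC rF ↦` the radii member, `cm c0m rowIm upperm Cbm Fm ↦` midpoint data.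
NOT COVERED: radii on equality rows (a fixed point cannot satisfy a moving equation; needs a
parametrised point / interval linear system as in [JanssonChaykinKeil2008] Alg. 4.1); blocks that are
PSD only on a face at the midpoint (margin `0` admits no radius); how the margins are certified. -/
theorem lmiForm_sInf_le_on_box (c cm : V → ℝ) (c0 c0m : ℝ) (u : V)
    (rowE : E → V → ℝ) (rhs : E → ℝ) (rowI rowIm : I → V → ℝ) (upper upperm : I → ℝ)
    (Cb Cbm : ∀ k, Matrix (σ k) (σ k) ℝ) (F Fm : ∀ k, V → Matrix (σ k) (σ k) ℝ) (ρ : V → ℝ)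
    -- the radii (the data box) and the instance-in-box hypotheses
    (rc : V → ℝ) (rc0 : ℝ) (rI : I → V → ℝ) (rU : I → ℝ)
    (rC : ∀ k, σ k → σ k → ℝ) (rF : ∀ k, V → σ k → σ k → ℝ)
    (hc : ∀ v, |c v - cm v| ≤ rc v) (hc0 : |c0 - c0m| ≤ rc0)
    (hI : ∀ i v, |rowI i v - rowIm i v| ≤ rI i v) (hU : ∀ i, |upper i - upperm i| ≤ rU i)
    (hCb : ∀ k a b, |Cb k a b - Cbm k a b| ≤ rC k a b)
    (hF : ∀ k v a b, |F k v a b - Fm k v a b| ≤ rF k v a b)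
    -- the certificate: one point, feasible for the midpoint program WITH MARGINS
    {yt : V → ℝ} (hyu : yt u = 1) (hρ : ∀ v, v ≠ u → |yt v| ≤ ρ v)
    (heq : ∀ e, ∑ v, rowE e v * yt v = rhs e)
    (hineq : ∀ i, ∑ v, rowIm i v * yt v + ∑ v, rI i v * |yt v| + rU i ≤ upperm i)
    (hherm : ∀ k, (Cb k + ∑ v, yt v • F k v).IsHermitian)
    (m : K → ℝ)
    (hpsd : ∀ k, (Cbm k + ∑ v, yt v • Fm k v - m k • (1 : Matrix (σ k) (σ k) ℝ)).PosSemidef)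
    (hm : ∀ k a, ∑ b, (rC k a b + ∑ v, rF k v a b * |yt v|) ≤ m k)
    -- the instance's value set is bounded below
    (hbdd : BddBelow {val : ℝ | ∃ y : V → ℝ, y u = 1 ∧ (∀ v, v ≠ u → |y v| ≤ ρ v) ∧
      (∀ e, ∑ v, rowE e v * y v = rhs e) ∧ (∀ i, ∑ v, rowI i v * y v ≤ upper i) ∧
      (∀ k, (Cb k + ∑ v, y v • F k v).PosSemidef) ∧ val = ∑ v, c v * y v + c0}) :
    sInf {val : ℝ | ∃ y : V → ℝ, y u = 1 ∧ (∀ v, v ≠ u → |y v| ≤ ρ v) ∧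
      (∀ e, ∑ v, rowE e v * y v = rhs e) ∧ (∀ i, ∑ v, rowI i v * y v ≤ upper i) ∧
      (∀ k, (Cb k + ∑ v, y v • F k v).PosSemidef) ∧ val = ∑ v, c v * y v + c0} ≤
      ∑ v, cm v * yt v + c0m + ∑ v, rc v * |yt v| + rc0 := by
  have hineq' := lmiForm_ineq_on_box rowI rowIm upper upperm rI rU hI hU hineq
  have hpsd' := lmiForm_psd_on_box Cb Cbm F Fm rC rF m hCb hF hherm hpsd hm
  exact (lmiForm_sInf_le_of_feasible c c0 u rowE rhs rowI upper Cb F ρ hyu hρ heq hineq' hpsd'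
    hbdd).trans (lmiForm_value_le_on_box c cm c0 c0m rc rc0 hc hc0 yt)

/-- theorem (**block margin from a certified floor**, the reader's glue for R3). If `M − f·1 ⪰ 0` (a
certified floor `f ≤ λ_min(M)`, e.g. the Cholesky-residual floor a verifier replays from the certificate's own
witness) and the radius budget satisfies `m ≤ f`, then `M − m·1 ⪰ 0` — the hypothesis `hpsd` of
`lmiForm_psd_on_box` / `lmiForm_sInf_le_on_box`.  (`M − m·1 = (M − f·1) + (f − m)·1`.)
[cite: Jansson2007, §4, p. 9 (interval input data) with Thm 4.2 (b)] — a COROLLARY ([folklore] Loewner-order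
shift); the two-line glue the reader-A text owner's word (engines REQUESTS L7332, rU-7/rU-13) names for the
rule «floor_k ≥ m_k». CERTIFICATE KIND: interval upper certificate, block margin check; FIELDS: `f ↦` the
replayed floor, `m ↦` the radius row-sum budget. NOT COVERED: how the floor is certified. -/
theorem posSemidef_sub_smul_of_floor_le {n : Type*} [Fintype n] [DecidableEq n]
    {M : Matrix n n ℝ} {f m : ℝ} (hM : (M - f • (1 : Matrix n n ℝ)).PosSemidef) (hmf : m ≤ f) :
    (M - m • (1 : Matrix n n ℝ)).PosSemidef := by
  have h1 : ((f - m) • (1 : Matrix n n ℝ)).PosSemidef :=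
    Matrix.PosSemidef.one.smul (sub_nonneg.mpr hmf)
  have h2 : M - m • (1 : Matrix n n ℝ) = (M - f • (1 : Matrix n n ℝ)) + (f - m) • (1 : Matrix n n ℝ) := by
    rw [sub_smul]; abel
  rw [h2]
  exact hM.add h1

end UpperBox

end JanssonChaykinKeil

end Literature.Computation.Certificates
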